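import Mathlib
import HarnessLib
import Literature.MathematicalPhysics.StatisticalMechanics.WeightedNormDomination

/-!
# Domination ALONG THE LIFT SECTION suffices for Lemma 8.4
# (Adams–Buchholz–Kotecký–Müller, proof of Lemma 8.4 — "Taylor expansion commutes with convolution")

`WeightedNormDomination.lean` derives the dominated-convergence hypothesis of the integration map
`R_{k+1}` from `WeightDominated T w μ`: around every field `φ₀`, UNIFORMLY over all fields `φ` that
are gauge-close to `φ₀`, `w(φ + ·)` is dominated by an integrable function.  For the weights of
[ABKM19] Ch. 7 this is too strong: `w_k^X` depends on the gradients on `X^{++} = X + [−2L^k,2L^k]^d`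
while the gauge of the norm `‖·‖_{k,X}` only sees `X* ⊆ X⁺` ((6.25)–(6.26)), so fields in the
kernel of the gauge can make `w_k^X(φ + ξ)` arbitrarily large.  The proof of
`TayNormLE.derivDominated`, however, only evaluates the weight at fields `σ(v) + ξ` in the range of
the LIFT SECTION `σ = gaugeSection T` (the derivatives of `K̄(v + Tξ)` in `v` are taken there).
This file records that weaker hypothesis and re-derives Lemma 8.4 from it:

* `WeightSectionDominated T w μ` — `∀ v₀, ∃ ε > 0, ∃ H integrable, ∀ ξ v, ‖v − v₀‖ < ε →
  w(σ v + ξ) ≤ H ξ`; `WeightDominated.section` (the old hypothesis implies the new one);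
* `TayNormLE.derivDominated_section`, **`TayNormLE.integral_comp_add_section`** (Lemma 8.4, `ℓ = 0`,
  from section domination, integrability of `w(φ + ·)` and the integration property (w7)).

Everything is proved; no named fact.

## References
* S. Adams, S. Buchholz, R. Kotecký, S. Müller, arXiv:1910.13564, Lemma 8.4 (proof), (6.25)–(6.26)
  [AdamsBuchholzKoteckyMuller2019].
-/

noncomputable section

namespace Literature.MathematicalPhysics.StatisticalMechanics.GradientRG

open MeasureTheory Finset Metric
open Literature.MathematicalPhysics.QuantumFieldTheory

variable {E V : Type*} [NormedAddCommGroup E] [NormedSpace ℝ E] [FiniteDimensional ℝ E]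
  [NormedAddCommGroup V] [NormedSpace ℝ V]
  {𝔸 : Type*} [NormedRing 𝔸] [NormedAlgebra ℝ 𝔸]

/-- **Domination along the lift section**: around every gauge value `v₀`, the translated weight at
the section fields, `ξ ↦ w(σ(v) + ξ)`, is bounded by one `μ`-integrable function for all `v` near
`v₀` (`σ = gaugeSection T`). [cite: AdamsBuchholzKoteckyMuller2019, Lemma 8.4 (proof)] -/
def WeightSectionDominated [MeasurableSpace E] (T : E →ₗ[ℝ] V) (w : E → ℝ) (μ : Measure E) : Prop :=
  ∀ v₀ : LinearMap.range T, ∃ ε > 0, ∃ H : E → ℝ, Integrable H μ ∧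
    ∀ (ξ : E) (v : LinearMap.range T), ‖v - v₀‖ < ε → w (gaugeSection T v + ξ) ≤ H ξ

omit [FiniteDimensional ℝ E] in
/-- Gauge-uniform domination implies domination along the section.
[cite: AdamsBuchholzKoteckyMuller2019, Lemma 8.4 (proof)] -/
theorem WeightDominated.section [MeasurableSpace E] {T : E →ₗ[ℝ] V} {w : E → ℝ} {μ : Measure E}
    (h : WeightDominated T w μ) : WeightSectionDominated T w μ := by
  intro v₀
  obtain ⟨ε, hε, H, hH, hdom⟩ := h (gaugeSection T v₀)
  refine ⟨ε, hε, H, hH, fun ξ v hv => hdom ξ _ ?_⟩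
  rw [map_sub, apply_gaugeSection, apply_gaugeSection, ← Submodule.coe_sub, Submodule.norm_coe]
  exact hv

namespace TayNormLE

variable [MeasurableSpace E] [OpensMeasurableSpace E] {T : E →ₗ[ℝ] V} {r₀ : ℕ} {w : E → ℝ}
  {K : E → 𝔸} {C : ℝ} {μ : Measure E}

/-- **The derivatives of the lift are dominated** under section domination only (same proof as
`TayNormLE.derivDominated`, which evaluates the weight only at section fields).
[cite: AdamsBuchholzKoteckyMuller2019, Lemma 8.4 (proof)] -/
theorem derivDominated_section (h : TayNormLE T r₀ w K C) (hC : 0 ≤ C) (hK : ContDiff ℝ r₀ K)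
    (hw : WeightSectionDominated T w μ) :
    DerivDominated r₀
      (fun (v : LinearMap.range T) (ξ : E) => gaugeLift T K (v + T.rangeRestrict ξ)) μ := by
  have hKbar : ContDiff ℝ r₀ (gaugeLift T K) := contDiff_gaugeLift T hK
  refine ⟨fun ξ => hKbar.comp (contDiff_id.add contDiff_const), fun p hp v => ?_, fun p hp v₀ => ?_⟩
  · have hp' : (p : WithTop ℕ∞) ≤ r₀ := by exact_mod_cast hp
    have hcont : Continuous fun ξ : E => iteratedFDeriv ℝ p (gaugeLift T K) (v + T.rangeRestrict ξ) :=
      (hKbar.continuous_iteratedFDeriv hp').comp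
        (continuous_const.add (gaugeRestrictCLM T).continuous)
    refine hcont.aestronglyMeasurable.congr (ae_of_all _ fun ξ => ?_)
    simp only
    rw [iteratedFDeriv_comp_add_right]
  · obtain ⟨ε, hε, H, hHint, hH⟩ := hw v₀
    refine ⟨fun ξ => (p.factorial : ℝ) * (C * |H ξ|), (hHint.abs.const_mul C).const_mul _,
      ε, hε, ae_of_all _ fun ξ v hv => ?_⟩
    rw [iteratedFDeriv_comp_add_right]
    have hpt : v + T.rangeRestrict ξ = T.rangeRestrict (gaugeSection T v + ξ) := by
      rw [map_add, rangeRestrict_gaugeSection]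
    rw [hpt]
    have h1 : ‖iteratedFDeriv ℝ p (gaugeLift T K) (T.rangeRestrict (gaugeSection T v + ξ))‖ ≤
        (p.factorial : ℝ) * tayNorm T r₀ K (gaugeSection T v + ξ) := by
      have hcoef := pow_div_factorial_mul_norm_iteratedFDeriv_le_tphiSeminorm r₀ zero_le_one
        (gaugeLift T K) (T.rangeRestrict (gaugeSection T v + ξ)) hp
      rw [one_pow, ← tayNorm_eq_tphiSeminorm] at hcoef
      have hfac : (0 : ℝ) < p.factorial := by positivity
      rw [div_mul_eq_mul_div, one_mul, div_le_iff₀ hfac] at hcoef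
      linarith [hcoef]
    have h2 : tayNorm T r₀ K (gaugeSection T v + ξ) ≤ C * w (gaugeSection T v + ξ) := h _
    have hvv : ‖v - v₀‖ < ε := by rwa [mem_ball, dist_eq_norm] at hv
    have h3 : w (gaugeSection T v + ξ) ≤ H ξ := hH ξ v hvv
    calc ‖iteratedFDeriv ℝ p (gaugeLift T K) (T.rangeRestrict (gaugeSection T v + ξ))‖
        ≤ (p.factorial : ℝ) * tayNorm T r₀ K (gaugeSection T v + ξ) := h1
      _ ≤ (p.factorial : ℝ) * (C * w (gaugeSection T v + ξ)) :=
          mul_le_mul_of_nonneg_left h2 (Nat.cast_nonneg _)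
      _ ≤ (p.factorial : ℝ) * (C * |H ξ|) :=
          mul_le_mul_of_nonneg_left (mul_le_mul_of_nonneg_left (h3.trans (le_abs_self _)) hC)
            (Nat.cast_nonneg _)

/-- **Lemma 8.4 (`ℓ = 0`) from section domination**: `‖K‖_{T,w} ≤ C` (`C ≥ 0`, `K` local and
`C^{r₀}`), `w` dominated along the section, `w(φ + ·)` integrable, and the integration property
`∫ w(φ+ξ) μ(dξ) ≤ A w'(φ)` ((w7)) give `‖∫ K(·+ξ) μ(dξ)‖_{T,w'} ≤ C·A`.
[cite: AdamsBuchholzKoteckyMuller2019, Lemma 8.4] -/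
theorem integral_comp_add_section [CompleteSpace 𝔸] {w' : E → ℝ} {A : ℝ} (h : TayNormLE T r₀ w K C)
    (hC : 0 ≤ C) (hK : ContDiff ℝ r₀ K) (hloc : IsGaugeLocal T K) (hdom : WeightSectionDominated T w μ)
    (hwint : ∀ φ, Integrable (fun ξ => w (φ + ξ)) μ) (hw : ∀ φ, ∫ ξ, w (φ + ξ) ∂μ ≤ A * w' φ) :
    TayNormLE T r₀ w' (fun ψ => ∫ ξ, K (ψ + ξ) ∂μ) (C * A) :=
  h.integral_comp_add hC hloc (h.derivDominated_section hC hK hdom) hwint hw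

end TayNormLE

end Literature.MathematicalPhysics.StatisticalMechanics.GradientRG

end
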